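/-
Origin: expansion seat `prover-pub-hodgecm-mc-carch-1-g4-0`, handover #CA35 2026-08-20T08:20Z md5 478e024d83c0 (109 l., 12 decls; NEW additive leaf; imports #CA34 (this kit) + installed sinst #1212 Model.ThetaAdelicSideReadOff; RUN 45; INSTALL after #CA34; cert certs/ax-ArchKTypeOfLineR1Family-478e024d83c0.log: rc 0 / 14 s / 0 warnings / 12/12 trio) (`HOME/mc/pub-hodgecm-mc-carch-1/pkg45/HodgeCM/Model/ArchKTypeOfLineR1Family.lean`, md5 478e024d83c0, 109 lines);
landed by the gen-17 packager (p-g17) in gate run 45 as `HodgeCM/Model/ArchKTypeOfLineR1Family.lean` (verbatim).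
-/
/-
Copyright (c) 2026. Released under Apache 2.0 license as described in the file LICENSE.
Cell pub-hodgecm, MODEL layer (construction prover mc-carch-1, gen 4), BINDER-OWNERS row 12 `C`, junction (C-Λ) § 5:
the read-off tables and characters as GUARDED FAMILY TERMS in E's binder style (for the R1-pin child of the E term).
-/
import Summits.HodgeConjecture.HodgeCM.Model.ArchKTypeOfLineSection
import Summits.HodgeConjecture.HodgeCM.Model.ThetaAdelicSideReadOff

/-!
# (C-Λ) § 5: the read-off data `nVRF`, `n₁RF`, `χVR`, `ν₁R`, `νR` as guarded FAMILY terms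

E's pins are families over `∀ {L} {ι₁} (V : HermSpace3 L ι₁) (c : SeesawCtx L)` guarded by `SInstance.GOG V c` (sinst #1212:
`(mk ι₁).embedding = ι₁ ∧ GoodCtx (orientBitι L ι₁) ι₁ c`, with `hG_GOG` = plane-definiteness at `ι₁` and `hpos_GOG` = the slot positivity facts).
This leaf packages the C lane's read-off (#CA33/#CA34) in that style, over the E-level splitting families `hGR hGR₀ hGR₁` only:

* `SInstance.nVRF @hGR @hGR₀ @hGR₁`, `SInstance.n₁RF @hGR₁ : ∀ {L ι₁} (V c), InfinitePlace L → ℤ` — the tables under the guard, `0` off it;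
* `SInstance.χVR := EtaChi.χOfType nVRF`, `SInstance.ν₁R := EtaChi.χOfType n₁RF` (unitary characters of those types, sinst's device) and the bare-hom twist
  family `SInstance.νR := νOf ν₁R` with `hνR`/`hνcR` (the `ν hν hνc` slots of #P43a `archSideOfT` / #1215);
* under the guard: `hasArchType_χVR_of_GOG : HasArchType (χVR V c) (nVR V c (hGR V c) (hGR₀ V c) (hGR₁ V c) (hG_GOG V c hG) …)`,
  `hasArchType_ν₁R_of_GOG` — exactly the `hnV`/`hn₁` inputs of #CA33 `hdef_zero/one_R1` and #CA34 `hχ_zero/one_R1`, so that at the pin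
  `archSideOfT … (EtaChi.η χVR χW …) … (νR …) …` the four row-12 PROVE inputs are discharged by those four theorems with `hemb := hG.1`.

0 records, 0 `def … : Prop`, nothing cited as a hypothesis.
-/

set_option autoImplicit false

noncomputable section

open NumberField NumberField.InfinitePlace
open scoped Matrix Classical
open Literature.NumberTheory.Automorphic Literature.NumberTheory.Weil1964
open Literature.NumberTheory.GelbartRogawski1991 Literature.NumberTheory.GelbartRogawski1991.UnitaryDualPair
open HodgeCM.Adelic HodgeCM.PerL34

namespace HodgeCM.Model.SInstance

variable
  (hGR : ∀ {L : CMField} {ι₁ : L →+* ℂ} (V : HermSpace3 L ι₁) (c : SeesawCtx L),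
    (cmSplittingDatum (L : Type) finProdFinEquiv (frameD V) (frameD_real V) (frameD_ne V) (dW c.D) (dW_real c.D)
      (dW_ne c.D)).CompatibleSplitting)
  (hGR₀ : ∀ {L : CMField} {ι₁ : L →+* ℂ} (V : HermSpace3 L ι₁) (c : SeesawCtx L),
    (cmSplittingDatum (L : Type) (ArchSideTerm.e₁) (frameD V) (frameD_real V) (frameD_ne V) (lineVec (L : Type) (dW c.D 0))
      (fun _ => dW_real c.D 0) (fun _ => dW_ne c.D 0)).CompatibleSplitting)
  (hGR₁ : ∀ {L : CMField} {ι₁ : L →+* ℂ} (V : HermSpace3 L ι₁) (c : SeesawCtx L),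
    (cmSplittingDatum (L : Type) (ArchSideTerm.e₁) (frameD V) (frameD_real V) (frameD_ne V) (lineVec (L : Type) (dW c.D 1))
      (fun _ => dW_real c.D 1) (fun _ => dW_ne c.D 1)).CompatibleSplitting)

/-- **the `χV`-type family of the R1 read-off**: `nVR` under the guard, `0` off it. -/
def nVRF : ∀ {L : CMField} {ι₁ : L →+* ℂ} (_V : HermSpace3 L ι₁) (_c : SeesawCtx L), InfinitePlace (L : Type) → ℤ :=
  fun V c => if hG : GOG V c then
    nVR V c (hGR V c) (hGR₀ V c) (hGR₁ V c) (hG_GOG V c hG) (hpos_GOG V c hG).1 (hpos_GOG V c hG).2.1 else 0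

/-- **the `ν₁`-type family of the R1 read-off**: `n₁R` under the guard, `0` off it. -/
def n₁RF : ∀ {L : CMField} {ι₁ : L →+* ℂ} (_V : HermSpace3 L ι₁) (_c : SeesawCtx L), InfinitePlace (L : Type) → ℤ :=
  fun V c => if hG : GOG V c then n₁R V c (hGR₁ V c) (hG_GOG V c hG) (hpos_GOG V c hG).2.1 else 0

/-- (Ported verbatim from the HodgeCMPerL package; no docstring in the source.) -/
theorem nVRF_of_GOG {L : CMField} {ι₁ : L →+* ℂ} (V : HermSpace3 L ι₁) (c : SeesawCtx L) (hG : GOG V c) :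
    @nVRF @hGR @hGR₀ @hGR₁ _ _ V c = nVR V c (hGR V c) (hGR₀ V c) (hGR₁ V c) (hG_GOG V c hG) (hpos_GOG V c hG).1 (hpos_GOG V c hG).2.1 := by
  unfold nVRF; rw [dif_pos hG]

/-- (Ported verbatim from the HodgeCMPerL package; no docstring in the source.) -/
theorem n₁RF_of_GOG {L : CMField} {ι₁ : L →+* ℂ} (V : HermSpace3 L ι₁) (c : SeesawCtx L) (hG : GOG V c) :
    @n₁RF @hGR₁ _ _ V c = n₁R V c (hGR₁ V c) (hG_GOG V c hG) (hpos_GOG V c hG).2.1 := by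
  unfold n₁RF; rw [dif_pos hG]

/-- **`χVR := χOfType nVRF`** — the CONSTRUCTED `V`-character family of the R1 read-off (replaces E's data group `χV`). -/
abbrev χVR : ∀ {L : CMField} {ι₁ : L →+* ℂ} (_V : HermSpace3 L ι₁) (_c : SeesawCtx L),
    ContinuousMonoidHom (Literature.NumberTheory.Automorphic.relNormOneIdeles (↥(NumberField.maximalRealSubfield (L : Type))) (L : Type) ⧸
      Literature.NumberTheory.Automorphic.relNormOneRat (↥(NumberField.maximalRealSubfield (L : Type))) (L : Type)) Circle :=
  @EtaChi.χOfType (@nVRF @hGR @hGR₀ @hGR₁)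

/-- **`ν₁R := χOfType n₁RF`** — the unitary character behind the R1 twist. -/
abbrev ν₁R : ∀ {L : CMField} {ι₁ : L →+* ℂ} (_V : HermSpace3 L ι₁) (_c : SeesawCtx L),
    ContinuousMonoidHom (Literature.NumberTheory.Automorphic.relNormOneIdeles (↥(NumberField.maximalRealSubfield (L : Type))) (L : Type) ⧸
      Literature.NumberTheory.Automorphic.relNormOneRat (↥(NumberField.maximalRealSubfield (L : Type))) (L : Type)) Circle :=
  @EtaChi.χOfType (@n₁RF @hGR₁)

/-- **`νR := νOf ν₁R`** — the R1 twist family as bare homs `U(V)(𝔸) →* ℂˣ` (the `ν` slot of #P43a / #1215). -/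
def νR : ∀ {L : CMField} {ι₁ : L →+* ℂ} (V : HermSpace3 L ι₁) (_c : SeesawCtx L), CMAdelic (L : Type) (frameD V) →* ℂˣ :=
  fun V c => νOf (@ν₁R @hGR₁) V c

/-- the `hν` slot. -/
theorem hνR : ∀ {L : CMField} {ι₁ : L →+* ℂ} (V : HermSpace3 L ι₁) (c : SeesawCtx L),
    ∀ γU ∈ CMRat (L : Type) (frameD V), @νR @hGR₁ _ _ V c γU = 1 :=
  fun V c => hνOf (@ν₁R @hGR₁) V c

/-- the `hνc` slot. -/
theorem hνcR : ∀ {L : CMField} {ι₁ : L →+* ℂ} (V : HermSpace3 L ι₁) (c : SeesawCtx L),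
    Continuous fun v => ((@νR @hGR₁ _ _ V c v : ℂˣ) : ℂ) :=
  fun V c => hνcOf (@ν₁R @hGR₁) V c

/-- (Ported verbatim from the HodgeCMPerL package; no docstring in the source.) -/
theorem νR_eq {L : CMField} {ι₁ : L →+* ℂ} (V : HermSpace3 L ι₁) (c : SeesawCtx L) : @νR @hGR₁ _ _ V c = νOf (@ν₁R @hGR₁) V c := rfl

/-- under the guard, `χVR` HAS the read-off type `nVR` (the `hnV` input of #CA33/#CA34). -/
theorem hasArchType_χVR_of_GOG {L : CMField} {ι₁ : L →+* ℂ} (V : HermSpace3 L ι₁) (c : SeesawCtx L) (hG : GOG V c) :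
    UnitaryLineChar.HasArchType (L : Type) (@χVR @hGR @hGR₀ @hGR₁ _ _ V c)
      (nVR V c (hGR V c) (hGR₀ V c) (hGR₁ V c) (hG_GOG V c hG) (hpos_GOG V c hG).1 (hpos_GOG V c hG).2.1) := by
  rw [← nVRF_of_GOG @hGR @hGR₀ @hGR₁ V c hG]
  exact EtaChi.hasArchType_χOfType _ V c

/-- under the guard, `ν₁R` HAS the read-off type `n₁R` (the `hn₁` input of #CA33/#CA34). -/
theorem hasArchType_ν₁R_of_GOG {L : CMField} {ι₁ : L →+* ℂ} (V : HermSpace3 L ι₁) (c : SeesawCtx L) (hG : GOG V c) :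
    UnitaryLineChar.HasArchType (L : Type) (@ν₁R @hGR₁ _ _ V c) (n₁R V c (hGR₁ V c) (hG_GOG V c hG) (hpos_GOG V c hG).2.1) := by
  rw [← n₁RF_of_GOG @hGR₁ V c hG]
  exact EtaChi.hasArchType_χOfType _ V c

end HodgeCM.Model.SInstance

end
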